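import Literature.Analysis.FunctionSpaces.SobolevTraceEmbeddingProofs
import HarnessLib

/-!
# The weak derivative of `|u|²` for `u ∈ W^{1,2}` (product rule)

Analysis/FunctionSpaces support file (serves the decomposition of the ε-regularity criterion
`Literature.Analysis.FluidPDE.ckn_epsilon_regularity`, Caffarelli–Kohn–Nirenberg 1982, Prop. 2,
through the local-energy estimate `Literature.Analysis.FluidPDE.localEnergyEstimate`;
Robinson–Rodrigo–Sadowski 2016, p. 241: "Using the inequality `|∇(|u|²)| ≤ 2|u||∇u|` we can
therefore estimate …", which presupposes that `|u|²` is weakly differentiable with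
`∇|u|² = 2 uᵀ∇u` when `u ∈ H¹`).

On a bounded Lipschitz domain `Ω` of a finite-dimensional real inner product space `E'`, for
`u ∈ W^{1,2}(Ω; F)` (values in a real Hilbert space `F`) with weak derivative `G`, the scalar
function `|u|²` has the weak derivative `x ↦ (v ↦ 2⟪u(x), G(x) v⟫)` on `Ω`
(`HasWeakFDerivOn.norm_sq`), lies in `W^{1,1}(Ω)` (`memSobolevDomain_one_one_norm_sq`), and
`‖∇|u|²‖_{L¹(Ω)} ≤ 2 ‖u‖_{L²(Ω)} ‖G‖_{L²(Ω)}` (`eLpNorm_weakDeriv_norm_sq_le`). Proof of the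
product rule: approximate `u` in `W^{1,2}(Ω)` by restrictions of smooth functions `ψₖ` (the
tree's density theorem `Literature.Analysis.FunctionSpaces.smooth_upToBoundary_dense_one` on bounded Lipschitz
domains), for which `∇|ψₖ|² = 2 ψₖᵀ∇ψₖ` classically (Mathlib's `HasFDerivAt.norm_sq`), and
pass to the limit in the integration-by-parts identity: `|ψₖ|² → |u|²` and
`⟪ψₖ, ∇ψₖ v⟫ → ⟪u, G v⟫` in `L¹(Ω)` by Hölder (Evans, *PDE*, §5.2.3, Thm. 1 (iv) and §5.3;
Gilbarg–Trudinger, Lemma 7.5 / (7.18)).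

## References

* L. C. Evans, *Partial Differential Equations*, 2nd ed. (2010), §5.2.3 Thm. 1, §5.3.3 Thm. 3.
* D. Gilbarg, N. S. Trudinger, *Elliptic partial differential equations of second order*
  (2001), §7.4, Lemma 7.5 and (7.18) (chain and product rules in `W^{1,p}`).
* J. C. Robinson, J. L. Rodrigo, W. Sadowski, *The three-dimensional Navier–Stokes equations*
  (2016), p. 241.
-/

noncomputable section

open MeasureTheory Set Filter Topology TopologicalSpace Metric Module Bornology
open scoped NNReal ENNReal InnerProductSpace RealInnerProductSpace

namespace Literature.Analysis.FunctionSpaces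

/-! ### `L¹` convergence tools -/

section L1

variable {α : Type*} [MeasurableSpace α] {μ : Measure α}
variable {F : Type*} [NormedAddCommGroup F] [InnerProductSpace ℝ F]

/-- Hölder for products of real functions: `‖φ ψ‖_{L¹} ≤ ‖φ‖_{L²} ‖ψ‖_{L²}`. [folklore] -/
theorem eLpNorm_mul_one_le_two_two {φ ψ : α → ℝ} (hφ : AEStronglyMeasurable φ μ)
    (hψ : AEStronglyMeasurable ψ μ) :
    eLpNorm (fun x => φ x * ψ x) 1 μ ≤ eLpNorm φ 2 μ * eLpNorm ψ 2 μ := by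
  have := eLpNorm_le_eLpNorm_mul_eLpNorm_of_nnnorm (p := 2) (q := 2) (r := 1) hφ hψ
    (fun s t : ℝ => s * t) 1 (Eventually.of_forall fun x => by simp [nnnorm_mul])
  simpa using this

omit [InnerProductSpace ℝ F] in
/-- `L¹`-convergence of squared norms from `L²`-convergence:
`‖ |a|² - |b|² ‖_{L¹} ≤ ‖a - b‖_{L²} (‖a - b‖_{L²} + 2‖b‖_{L²})`. [folklore] -/
theorem eLpNorm_norm_sq_sub_norm_sq_le {a b : α → F} (ha : AEStronglyMeasurable a μ)
    (hb : AEStronglyMeasurable b μ) :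
    eLpNorm (fun x => ‖a x‖ ^ 2 - ‖b x‖ ^ 2) 1 μ ≤
      eLpNorm (a - b) 2 μ * (eLpNorm (a - b) 2 μ + 2 * eLpNorm b 2 μ) := by
  -- pointwise `| ‖a‖² - ‖b‖² | ≤ ‖a - b‖ (‖a - b‖ + 2‖b‖)`
  have hpt : ∀ x, ‖‖a x‖ ^ 2 - ‖b x‖ ^ 2‖ ≤ ‖‖a x - b x‖ * (‖a x - b x‖ + 2 * ‖b x‖)‖ := by
    intro x
    rw [Real.norm_eq_abs, Real.norm_eq_abs,
      abs_of_nonneg (by positivity : (0 : ℝ) ≤ ‖a x - b x‖ * (‖a x - b x‖ + 2 * ‖b x‖))]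
    have h1 : ‖a x‖ ≤ ‖a x - b x‖ + ‖b x‖ := norm_le_norm_sub_add _ _
    have h2 : ‖b x‖ ≤ ‖a x - b x‖ + ‖a x‖ := by
      rw [← norm_neg (a x - b x), neg_sub]; exact norm_le_norm_sub_add _ _
    rw [abs_le]
    constructor <;> nlinarith [norm_nonneg (a x), norm_nonneg (b x), norm_nonneg (a x - b x)]
  have h1m : AEStronglyMeasurable (fun x => ‖a x - b x‖) μ := (ha.sub hb).norm
  have h2m : AEStronglyMeasurable (fun x => ‖a x - b x‖ + 2 * ‖b x‖) μ :=
    h1m.add (hb.norm.const_mul 2)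
  calc eLpNorm (fun x => ‖a x‖ ^ 2 - ‖b x‖ ^ 2) 1 μ
      ≤ eLpNorm (fun x => ‖a x - b x‖ * (‖a x - b x‖ + 2 * ‖b x‖)) 1 μ :=
        eLpNorm_mono fun x => hpt x
    _ ≤ eLpNorm (fun x => ‖a x - b x‖) 2 μ * eLpNorm (fun x => ‖a x - b x‖ + 2 * ‖b x‖) 2 μ :=
        eLpNorm_mul_one_le_two_two h1m h2m
    _ ≤ eLpNorm (a - b) 2 μ * (eLpNorm (a - b) 2 μ + 2 * eLpNorm b 2 μ) := by
        gcongr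
        · exact (eLpNorm_norm (a - b)).le
        · calc eLpNorm (fun x => ‖a x - b x‖ + 2 * ‖b x‖) 2 μ
              ≤ eLpNorm (fun x => ‖a x - b x‖) 2 μ + eLpNorm (fun x => 2 * ‖b x‖) 2 μ :=
                eLpNorm_add_le h1m (hb.norm.const_mul 2) one_le_two
            _ = eLpNorm (a - b) 2 μ + 2 * eLpNorm b 2 μ := by
                congr 1
                · exact eLpNorm_norm (a - b)
                · have e : (fun x => 2 * ‖b x‖) = (2 : ℝ) • fun x => ‖b x‖ := by
                    funext x; simp
                  rw [e, eLpNorm_const_smul, eLpNorm_norm, Real.enorm_eq_ofReal zero_le_two,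
                    ENNReal.ofReal_ofNat]

/-- `L¹`-convergence of inner products: for vector fields `a, b` and `c, d`,
`‖⟪a, c⟫ - ⟪b, d⟫‖_{L¹} ≤ ‖a - b‖_{L²} ‖c‖_{L²} + ‖b‖_{L²} ‖c - d‖_{L²}`. [folklore] -/
theorem eLpNorm_inner_sub_inner_le {a b c d : α → F} (ha : AEStronglyMeasurable a μ)
    (hb : AEStronglyMeasurable b μ) (hc : AEStronglyMeasurable c μ)
    (hd : AEStronglyMeasurable d μ) :
    eLpNorm (fun x => ⟪a x, c x⟫ - ⟪b x, d x⟫) 1 μ ≤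
      eLpNorm (a - b) 2 μ * eLpNorm c 2 μ + eLpNorm b 2 μ * eLpNorm (c - d) 2 μ := by
  have hsplit : ∀ x, ⟪a x, c x⟫ - ⟪b x, d x⟫ = ⟪a x - b x, c x⟫ + ⟪b x, c x - d x⟫ := by
    intro x; rw [inner_sub_left, inner_sub_right]; ring
  have hm1 : AEStronglyMeasurable (fun x => ⟪a x - b x, c x⟫) μ := (ha.sub hb).inner hc
  have hm2 : AEStronglyMeasurable (fun x => ⟪b x, c x - d x⟫) μ := hb.inner (hc.sub hd)
  have hH : ∀ {f g : α → F}, AEStronglyMeasurable f μ → AEStronglyMeasurable g μ →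
      eLpNorm (fun x => ⟪f x, g x⟫) 1 μ ≤ eLpNorm f 2 μ * eLpNorm g 2 μ := by
    intro f g hf hg
    have := eLpNorm_le_eLpNorm_mul_eLpNorm_of_nnnorm (p := 2) (q := 2) (r := 1) hf hg
      (fun y z : F => ⟪y, z⟫) 1 (Eventually.of_forall fun x => by
        rw [← NNReal.coe_le_coe]; push_cast; rw [one_mul]; exact norm_inner_le_norm _ _)
    simpa using this
  calc eLpNorm (fun x => ⟪a x, c x⟫ - ⟪b x, d x⟫) 1 μ
      = eLpNorm ((fun x => ⟪a x - b x, c x⟫) + fun x => ⟪b x, c x - d x⟫) 1 μ := by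
        congr 1; funext x; simp only [Pi.add_apply, hsplit]
    _ ≤ eLpNorm (fun x => ⟪a x - b x, c x⟫) 1 μ + eLpNorm (fun x => ⟪b x, c x - d x⟫) 1 μ :=
        eLpNorm_add_le hm1 hm2 le_rfl
    _ ≤ eLpNorm (a - b) 2 μ * eLpNorm c 2 μ + eLpNorm b 2 μ * eLpNorm (c - d) 2 μ :=
        add_le_add (hH (ha.sub hb) hc) (hH hb (hc.sub hd))

/-- Integrals against a bounded weight converge when the functions converge in `L¹`. [folklore] -/
theorem tendsto_integral_mul_of_eLpNorm_sub_tendsto_zero {c : α → ℝ} (hc : AEStronglyMeasurable c μ)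
    {C : ℝ} (hC : ∀ x, ‖c x‖ ≤ C) {Φ : ℕ → α → ℝ} {Φ' : α → ℝ} (hΦ : ∀ k, Integrable (Φ k) μ)
    (hΦ' : Integrable Φ' μ)
    (hlim : Tendsto (fun k => eLpNorm (fun x => Φ k x - Φ' x) 1 μ) atTop (𝓝 0)) :
    Tendsto (fun k => ∫ x, c x * Φ k x ∂μ) atTop (𝓝 (∫ x, c x * Φ' x ∂μ)) := by
  refine tendsto_integral_of_L1 (fun x => c x * Φ' x) (hc.mul hΦ'.aestronglyMeasurable)
    (Eventually.of_forall fun k => (hΦ k).bdd_mul hc (Eventually.of_forall hC)) ?_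
  -- `∫ ‖c (Φₖ - Φ')‖ ≤ C ‖Φₖ - Φ'‖_{L¹} → 0`
  have hbound : ∀ k, ∫⁻ x, ‖c x * Φ k x - c x * Φ' x‖ₑ ∂μ ≤
      ENNReal.ofReal C * eLpNorm (fun x => Φ k x - Φ' x) 1 μ := fun k => by
    rw [eLpNorm_one_eq_lintegral_enorm, ← lintegral_const_mul' _ _ ENNReal.ofReal_ne_top]
    refine lintegral_mono fun x => ?_
    rw [← mul_sub, enorm_mul]
    gcongr
    rw [← ofReal_norm]
    exact ENNReal.ofReal_le_ofReal (hC x)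
  refine tendsto_of_tendsto_of_tendsto_of_le_of_le tendsto_const_nhds ?_ (fun k => bot_le) hbound
  have := ENNReal.Tendsto.const_mul (a := ENNReal.ofReal C) hlim (Or.inr ENNReal.ofReal_ne_top)
  simpa using this

end L1

/-! ### The product rule for `|u|²` -/

section NormSq

variable {E' : Type*} [NormedAddCommGroup E'] [InnerProductSpace ℝ E'] [MeasurableSpace E']
  [BorelSpace E'] [FiniteDimensional ℝ E']
variable {F : Type*} [NormedAddCommGroup F] [InnerProductSpace ℝ F] [CompleteSpace F]

omit [MeasurableSpace E'] [BorelSpace E'] [FiniteDimensional ℝ E'] [CompleteSpace F] in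
/-- Pointwise bound for the candidate derivative: `‖2 (u·)∘G‖ ≤ 2 ‖u‖ ‖G‖`. [folklore] -/
theorem norm_two_smul_innerSL_comp_le (y : F) (L : E' →L[ℝ] F) :
    ‖(2 : ℝ) • (innerSL ℝ y).comp L‖ ≤ 2 * (‖y‖ * ‖L‖) := by
  calc ‖(2 : ℝ) • (innerSL ℝ y).comp L‖ = ‖(2 : ℝ)‖ * ‖(innerSL ℝ y).comp L‖ := norm_smul _ _
    _ ≤ 2 * (‖innerSL ℝ y‖ * ‖L‖) := by
        rw [Real.norm_ofNat]; gcongr; exact ContinuousLinearMap.opNorm_comp_le _ _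
    _ = 2 * (‖y‖ * ‖L‖) := by rw [innerSL_apply_norm]

/-- **Product rule: the weak derivative of `|u|²` for `u ∈ W^{1,2}`.** On a bounded Lipschitz
domain `Ω`, if `u ∈ W^{1,2}(Ω; F)` has the weak derivative `G`, then `|u|²` has the weak
derivative `x ↦ (v ↦ 2⟪u(x), G(x) v⟫)` on `Ω` (Evans, *PDE*, §5.2.3 Thm. 1 (iv) with the density
theorem §5.3.3; Gilbarg–Trudinger, (7.18); used in Robinson–Rodrigo–Sadowski 2016, p. 241 as
`|∇|u|²| ≤ 2|u||∇u|`). See the file docstring for the proof. [cite: Evans2010, §5.2.3 Thm. 1 and §5.3.3 Thm. 3] -/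
theorem HasWeakFDerivOn.norm_sq {Ω : Opens E'} (hΩ : IsLipschitzDomain Ω)
    (hb : IsBounded (Ω : Set E')) {μ : Measure E'} [μ.IsAddHaarMeasure] {u : E' → F}
    {G : E' → E' →L[ℝ] F} (hu : MemSobolevDomain 1 2 Ω μ u) (hG : HasWeakFDerivOn Ω μ u G) :
    HasWeakFDerivOn Ω μ (fun x => ‖u x‖ ^ 2) (fun x => (2 : ℝ) • (innerSL ℝ (u x)).comp (G x)) := by
  set ν := μ.restrict (Ω : Set E') with hν
  haveI : IsFiniteMeasure ν := isFiniteMeasure_restrict.2 hb.measure_lt_top.ne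
  have huL2 : MemLp u 2 ν := hu.memLp
  -- `G ∈ L²(Ω)` as an operator-valued map
  have hGm : AEStronglyMeasurable G ν := hG.locallyIntegrableOn_deriv.aestronglyMeasurable
  have hGL2 : MemLp G 2 ν := by
    obtain ⟨-, g', hg', hg'2⟩ := (memSobolevDomain_succ_iff (k := 0)).1 hu
    have hae := HasWeakFDerivOn.unique_holds hg' hG
    set b := Module.finBasis ℝ E'
    obtain ⟨Cb, -, hCb⟩ := exists_opNorm_le_mul_sum_basis (F := F) b
    refine ⟨hGm, ?_⟩
    refine (eLpNorm_le_mul_sum_eLpNorm_apply_basis b hCb hGm (by norm_num)).trans_lt ?_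
    refine ENNReal.mul_lt_top ENNReal.coe_lt_top (ENNReal.sum_lt_top.2 fun i _ => ?_)
    have h1 : MemLp (fun x => g' x (b i)) 2 ν := (memSobolevDomain_zero_iff).1 (hg'2 (b i))
    exact (h1.ae_eq (hae.mono fun x hx => by rw [hx])).eLpNorm_lt_top
  have hGvL2 : ∀ v, MemLp (fun x => G x v) 2 ν := fun v =>
    (ContinuousLinearMap.apply ℝ F v).comp_memLp' hGL2
  -- integrability of `|u|²` and of the candidate derivative
  have hu2int : Integrable (fun x => ‖u x‖ ^ 2) ν :=
    (memLp_two_iff_integrable_sq_norm huL2.1).1 huL2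
  set H : E' → E' →L[ℝ] ℝ := fun x => (2 : ℝ) • (innerSL ℝ (u x)).comp (G x) with hH
  have hHm : AEStronglyMeasurable H ν := by
    have h1 : AEStronglyMeasurable (fun x => innerSL ℝ (u x)) ν :=
      (innerSL ℝ (E := F)).continuous.comp_aestronglyMeasurable huL2.1
    have h2 := ((ContinuousLinearMap.compL ℝ E' F ℝ).aestronglyMeasurable_comp₂ h1 hGm).const_smul
      (2 : ℝ)
    refine h2.congr (Eventually.of_forall fun x => ?_)
    simp only [hH, ContinuousLinearMap.compL_apply, Pi.smul_apply]
  have hHint : Integrable H ν := by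
    have hprod : Integrable ((fun x => ‖u x‖) * fun x => ‖G x‖) ν :=
      huL2.norm.integrable_mul hGL2.norm
    refine (hprod.const_mul 2).mono' hHm (Eventually.of_forall fun x => ?_)
    simpa [hH, Pi.mul_apply] using norm_two_smul_innerSL_comp_le (u x) (G x)
  have hu2int' : IntegrableOn (fun x => ‖u x‖ ^ 2) (Ω : Set E') μ := hu2int
  have hHint' : IntegrableOn H (Ω : Set E') μ := hHint
  refine ⟨hu2int'.locallyIntegrableOn, hHint'.locallyIntegrableOn, fun φ v hφ => ?_⟩
  -- smooth approximations of `u` in `W^{1,2}(Ω)`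
  obtain ⟨ψ, hψ, hlim⟩ := smooth_upToBoundary_dense_one hΩ hb (p := 2) (by norm_num)
    (by simp) μ hu
  have hψ1 : ∀ k, ContDiff ℝ 1 (ψ k) := fun k => (hψ k).of_le (by exact_mod_cast le_top)
  have hDlim := tendsto_eLpNorm_fderiv_of_tendsto_eSobolevDomainNorm_of_contDiff (by norm_num)
    hG hψ1 hlim
  have hLp : Tendsto (fun k => eLpNorm (u - ψ k) 2 ν) atTop (𝓝 0) :=
    tendsto_of_tendsto_of_tendsto_of_le_of_le tendsto_const_nhds hlim (fun _ => bot_le)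
      fun _ => eLpNorm_le_eSobolevDomainNorm
  have hLp' : Tendsto (fun k => eLpNorm (ψ k - u) 2 ν) atTop (𝓝 0) := by
    simpa only [eLpNorm_sub_comm] using hLp
  -- measurability and integrability of the approximants on `Ω`
  have hψm : ∀ k, AEStronglyMeasurable (ψ k) ν := fun k => (hψ k).continuous.aestronglyMeasurable
  have hψL2 : ∀ k, MemLp (ψ k) 2 ν := fun k =>
    SobolevApprox.memLp_restrict_of_continuous_of_isBounded (hψ k).continuous hb
  have hDψc : ∀ k, Continuous fun x => fderiv ℝ (ψ k) x v := fun k =>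
    ((hψ1 k).continuous_fderiv one_ne_zero).clm_apply continuous_const
  have hDψL2 : ∀ k, MemLp (fun x => fderiv ℝ (ψ k) x v) 2 ν := fun k =>
    SobolevApprox.memLp_restrict_of_continuous_of_isBounded (hDψc k) hb
  -- the classical identity for `ψ k`
  have hclass : ∀ k, ∫ x in (Ω : Set E'), fderiv ℝ φ x v * ‖ψ k x‖ ^ 2 ∂μ =
      -∫ x in (Ω : Set E'), φ x * (2 * ⟪ψ k x, fderiv ℝ (ψ k) x v⟫) ∂μ := by
    intro k
    have hw := HasWeakFDerivOn.of_contDiff_holds Ω μ ((hψ1 k).norm_sq (𝕜 := ℝ))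
    have hid := hw.integral_fderiv_smul_eq φ v hφ
    have hd : ∀ x, fderiv ℝ (fun x => ‖ψ k x‖ ^ 2) x v = 2 * ⟪ψ k x, fderiv ℝ (ψ k) x v⟫ := by
      intro x
      rw [(((hψ1 k).differentiable one_ne_zero x).hasFDerivAt.norm_sq).fderiv]
      simp [innerSL_apply_apply]
    simp only [smul_eq_mul, hd] at hid
    exact hid
  -- limit of the left-hand sides
  obtain ⟨C₁, hC₁⟩ := (hφ.contDiff.continuous_fderiv (by simp)).bounded_above_of_compact_support
    (hφ.hasCompactSupport.mono' (support_fderiv_subset ℝ))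
  have hCφ' : ∀ x, ‖fderiv ℝ φ x v‖ ≤ C₁ * ‖v‖ := fun x =>
    (ContinuousLinearMap.le_opNorm _ _).trans (mul_le_mul_of_nonneg_right (hC₁ x) (norm_nonneg _))
  have hL : Tendsto (fun k => ∫ x in (Ω : Set E'), fderiv ℝ φ x v * ‖ψ k x‖ ^ 2 ∂μ) atTop
      (𝓝 (∫ x in (Ω : Set E'), fderiv ℝ φ x v * ‖u x‖ ^ 2 ∂μ)) := by
    refine tendsto_integral_mul_of_eLpNorm_sub_tendsto_zero
      (((hφ.contDiff.continuous_fderiv (by simp)).clm_apply continuous_const).aestronglyMeasurable)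
      hCφ' (fun k => (memLp_two_iff_integrable_sq_norm (hψm k)).1 (hψL2 k)) hu2int ?_
    have hbd : ∀ k, eLpNorm (fun x => ‖ψ k x‖ ^ 2 - ‖u x‖ ^ 2) 1 ν ≤
        eLpNorm (ψ k - u) 2 ν * (eLpNorm (ψ k - u) 2 ν + 2 * eLpNorm u 2 ν) := fun k =>
      eLpNorm_norm_sq_sub_norm_sq_le (hψm k) huL2.1
    refine tendsto_of_tendsto_of_tendsto_of_le_of_le tendsto_const_nhds ?_ (fun _ => bot_le) hbd
    have hfin : (0 : ℝ≥0∞) + 2 * eLpNorm u 2 ν ≠ ∞ := by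
      rw [zero_add]; exact ENNReal.mul_ne_top (by simp) huL2.eLpNorm_ne_top
    have := ENNReal.Tendsto.mul hLp' (Or.inr hfin) (hLp'.add tendsto_const_nhds)
      (Or.inr ENNReal.zero_ne_top)
    simpa using this
  -- limit of the right-hand sides
  obtain ⟨C₂, hC₂⟩ := hφ.contDiff.continuous.bounded_above_of_compact_support hφ.hasCompactSupport
  have hII : ∀ {a b : E' → F}, MemLp a 2 ν → MemLp b 2 ν → Integrable (fun x => ⟪a x, b x⟫) ν :=
    fun {a b} ha hb' => (ha.norm.integrable_mul hb'.norm).mono' (ha.1.inner hb'.1)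
      (Eventually.of_forall fun x => by
        simpa [Pi.mul_apply, Real.norm_eq_abs] using abs_real_inner_le_norm (a x) (b x))
  have huGv : Integrable (fun x => ⟪u x, G x v⟫) ν := hII huL2 (hGvL2 v)
  have hR : Tendsto (fun k => ∫ x in (Ω : Set E'), φ x * (2 * ⟪ψ k x, fderiv ℝ (ψ k) x v⟫) ∂μ) atTop
      (𝓝 (∫ x in (Ω : Set E'), φ x * (2 * ⟪u x, G x v⟫) ∂μ)) := by
    refine tendsto_integral_mul_of_eLpNorm_sub_tendsto_zero
      hφ.contDiff.continuous.aestronglyMeasurable hC₂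
      (fun k => (hII (hψL2 k) (hDψL2 k)).const_mul 2)
      (huGv.const_mul 2) ?_
    -- `‖2⟪ψₖ, Dψₖ v⟫ - 2⟪u, G v⟫‖_{L¹} → 0`
    set a : ℕ → ℝ≥0∞ := fun k => eLpNorm (ψ k - u) 2 ν with ha
    set d : ℕ → ℝ≥0∞ := fun k => eLpNorm (fun x => fderiv ℝ (ψ k) x - G x) 2 ν with hd
    have hd0 : Tendsto d atTop (𝓝 0) := by
      refine hDlim.congr fun k => ?_
      simp only [hd]
      rw [← eLpNorm_neg]
      congr 1; funext x; simp
    have hdv : ∀ k, eLpNorm (fun x => fderiv ℝ (ψ k) x v - G x v) 2 ν ≤ (‖v‖₊ : ℝ≥0∞) * d k := by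
      intro k
      have h := eLpNorm_le_nnreal_smul_eLpNorm_of_ae_le_mul (f := fun x => fderiv ℝ (ψ k) x v - G x v)
        (g := fun x => fderiv ℝ (ψ k) x - G x) (c := ‖v‖₊) (μ := ν)
        (Eventually.of_forall fun x => by
          show ‖(fderiv ℝ (ψ k) x) v - (G x) v‖₊ ≤ ‖v‖₊ * ‖fderiv ℝ (ψ k) x - G x‖₊
          have e : (fderiv ℝ (ψ k) x) v - (G x) v = (fderiv ℝ (ψ k) x - G x) v := rfl
          rw [e, mul_comm]
          exact (fderiv ℝ (ψ k) x - G x).le_opNNNorm v) 2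
      rwa [ENNReal.smul_def, smul_eq_mul] at h
    have hDψv : ∀ k, eLpNorm (fun x => fderiv ℝ (ψ k) x v) 2 ν ≤
        eLpNorm (fun x => G x v) 2 ν + (‖v‖₊ : ℝ≥0∞) * d k := fun k => by
      have e : (fun x => fderiv ℝ (ψ k) x v) =
          (fun x => G x v) + fun x => fderiv ℝ (ψ k) x v - G x v := by
        funext x; simp
      rw [e]
      exact (eLpNorm_add_le (hGvL2 v).1 ((hDψL2 k).1.sub (hGvL2 v).1) one_le_two).trans
        (add_le_add le_rfl (hdv k))
    have hbd : ∀ k, eLpNorm (fun x => φ x * 0 + (2 * ⟪ψ k x, fderiv ℝ (ψ k) x v⟫ -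
        2 * ⟪u x, G x v⟫)) 1 ν ≤
        2 * (a k * (eLpNorm (fun x => G x v) 2 ν + (‖v‖₊ : ℝ≥0∞) * d k) +
          eLpNorm u 2 ν * ((‖v‖₊ : ℝ≥0∞) * d k)) := fun k => by
      have e : (fun x => φ x * 0 + (2 * ⟪ψ k x, fderiv ℝ (ψ k) x v⟫ - 2 * ⟪u x, G x v⟫)) =
          (2 : ℝ) • fun x => ⟪ψ k x, fderiv ℝ (ψ k) x v⟫ - ⟪u x, G x v⟫ := by
        funext x; simp only [Pi.smul_apply, smul_eq_mul]; ring
      rw [e, eLpNorm_const_smul, Real.enorm_eq_ofReal zero_le_two, ENNReal.ofReal_ofNat]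
      gcongr
      refine (eLpNorm_inner_sub_inner_le (hψm k) huL2.1 (hDψL2 k).1 (hGvL2 v).1).trans ?_
      gcongr
      · exact hDψv k
      · exact hdv k
    have hbd' : ∀ k, eLpNorm (fun x => 2 * ⟪ψ k x, fderiv ℝ (ψ k) x v⟫ - 2 * ⟪u x, G x v⟫) 1 ν ≤
        2 * (a k * (eLpNorm (fun x => G x v) 2 ν + (‖v‖₊ : ℝ≥0∞) * d k) +
          eLpNorm u 2 ν * ((‖v‖₊ : ℝ≥0∞) * d k)) := fun k => by
      simpa using hbd k
    refine tendsto_of_tendsto_of_tendsto_of_le_of_le tendsto_const_nhds ?_ (fun _ => bot_le) hbd'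
    -- the bound tends to `0`
    have hg : eLpNorm (fun x => G x v) 2 ν ≠ ∞ := (hGvL2 v).eLpNorm_ne_top
    have hvd : Tendsto (fun k => (‖v‖₊ : ℝ≥0∞) * d k) atTop (𝓝 0) := by
      have := ENNReal.Tendsto.const_mul (a := (‖v‖₊ : ℝ≥0∞)) hd0 (Or.inr ENNReal.coe_ne_top)
      simpa using this
    have h1 : Tendsto (fun k => a k * (eLpNorm (fun x => G x v) 2 ν + (‖v‖₊ : ℝ≥0∞) * d k)) atTop
        (𝓝 0) := by
      have hsum := (tendsto_const_nhds (x := eLpNorm (fun x => G x v) 2 ν)).add hvd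
      rw [add_zero] at hsum
      have := ENNReal.Tendsto.mul hLp' (Or.inr hg) hsum (Or.inr ENNReal.zero_ne_top)
      simpa using this
    have h2 : Tendsto (fun k => eLpNorm u 2 ν * ((‖v‖₊ : ℝ≥0∞) * d k)) atTop (𝓝 0) := by
      have := ENNReal.Tendsto.const_mul (a := eLpNorm u 2 ν) hvd (Or.inr huL2.eLpNorm_ne_top)
      simpa using this
    have := ENNReal.Tendsto.const_mul (a := (2 : ℝ≥0∞)) (h1.add h2) (Or.inr (by simp))
    simpa using this
  -- conclusion: pass to the limit in the classical identities
  have hlimEq : ∫ x in (Ω : Set E'), fderiv ℝ φ x v * ‖u x‖ ^ 2 ∂μ =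
      -∫ x in (Ω : Set E'), φ x * (2 * ⟪u x, G x v⟫) ∂μ := by
    refine tendsto_nhds_unique hL ?_
    simp_rw [hclass]
    exact hR.neg
  have hHv : ∀ x, H x v = 2 * ⟪u x, G x v⟫ := fun x => by
    simp [hH, innerSL_apply_apply]
  simp only [smul_eq_mul, hHv]
  exact hlimEq

/-- **`|u|² ∈ W^{1,1}(Ω)` for `u ∈ W^{1,2}(Ω)`** on a bounded Lipschitz domain (Evans, *PDE*,
§5.2.3; Gilbarg–Trudinger, (7.18)). [cite: Evans2010, §5.2.3 Thm. 1 and §5.3.3 Thm. 3] -/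
theorem memSobolevDomain_one_one_norm_sq {Ω : Opens E'} (hΩ : IsLipschitzDomain Ω)
    (hb : IsBounded (Ω : Set E')) {μ : Measure E'} [μ.IsAddHaarMeasure] {u : E' → F}
    {G : E' → E' →L[ℝ] F} (hu : MemSobolevDomain 1 2 Ω μ u) (hG : HasWeakFDerivOn Ω μ u G) :
    MemSobolevDomain 1 1 Ω μ (fun x => ‖u x‖ ^ 2) := by
  set ν := μ.restrict (Ω : Set E') with hν
  have huL2 : MemLp u 2 ν := hu.memLp
  have hGvL2 : ∀ v, MemLp (fun x => G x v) 2 ν := by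
    obtain ⟨-, g', hg', hg'2⟩ := (memSobolevDomain_succ_iff (k := 0)).1 hu
    have hae := HasWeakFDerivOn.unique_holds hg' hG
    intro v
    have h1 : MemLp (fun x => g' x v) 2 ν := (memSobolevDomain_zero_iff).1 (hg'2 v)
    exact h1.ae_eq (hae.mono fun x hx => by rw [hx])
  refine (memSobolevDomain_succ_iff (k := 0)).2 ⟨?_, _, hG.norm_sq hΩ hb hu, fun v => ?_⟩
  · exact memLp_one_iff_integrable.2 ((memLp_two_iff_integrable_sq_norm huL2.1).1 huL2)
  · rw [memSobolevDomain_zero_iff, memLp_one_iff_integrable]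
    have hi : Integrable (fun x => 2 * ⟪u x, G x v⟫) ν :=
      ((huL2.norm.integrable_mul (hGvL2 v).norm).mono' (huL2.1.inner (hGvL2 v).1)
        (Eventually.of_forall fun x => by
          simpa [Pi.mul_apply, Real.norm_eq_abs] using abs_real_inner_le_norm (u x) (G x v))).const_mul 2
    refine hi.congr (Eventually.of_forall fun x => ?_)
    simp [innerSL_apply_apply]

omit [BorelSpace E'] [FiniteDimensional ℝ E'] [CompleteSpace F] in
/-- **`‖∇|u|²‖_{L¹} ≤ 2 ‖u‖_{L²} ‖∇u‖_{L²}`** for the weak derivative of `|u|²`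
(`|∇(|u|²)| ≤ 2|u||∇u|` and Hölder; Robinson–Rodrigo–Sadowski 2016, p. 241). [cite: RobinsonRodrigoSadowski2016, p. 241] -/
theorem eLpNorm_two_smul_innerSL_comp_le {ν : Measure E'} {u : E' → F} {G : E' → E' →L[ℝ] F}
    (hu : AEStronglyMeasurable u ν) (hG : AEStronglyMeasurable G ν) :
    eLpNorm (fun x => (2 : ℝ) • (innerSL ℝ (u x)).comp (G x)) 1 ν ≤
      2 * eLpNorm u 2 ν * eLpNorm G 2 ν := by
  have := eLpNorm_le_eLpNorm_mul_eLpNorm_of_nnnorm (p := 2) (q := 2) (r := 1) hu hG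
    (fun (y : F) (L : E' →L[ℝ] F) => (2 : ℝ) • (innerSL ℝ y).comp L) 2
    (Eventually.of_forall fun x => by
      rw [← NNReal.coe_le_coe]; push_cast
      exact (norm_two_smul_innerSL_comp_le (u x) (G x)).trans_eq (by ring))
  simpa [mul_assoc] using this

end NormSq

end Literature.Analysis.FunctionSpaces
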